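import Summits.CriticalPhenomena.PercolationContinuityZ3.Theorems.PercNearOneGluingNoHeavyLowerTailThreePointProductFormFibreTwoPortProductForm
import Summits.CriticalPhenomena.PercolationContinuityZ3.Theorems.PercNearOneGluingNoHeavyLowerTailThreePointProductFormFibreTwoPortSubstitutionS1J
import HarnessLib

/-!
# The system 𝒮 = {(P), (S1J), (S1J′)} in the fibre language: two-terminal substitution for `w` and `J` (counting part) and REDUCTION R4 FOR (S1J)
# (Sahi programme, prover prim-sahi-p2 gen 57)

Support file (`--supports stmt-CriticalPhenomena-4575`, helper); completes the formalisation of reduction R4 for the system 𝒮 begun in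
`…FibreTwoPortSubstitutionS1J` (gen 56: pointwise lemmas `w_iff_restW`, `joined_iff_rest`) after `…FibreTwoPortSubstitutionCount` /
`…FibreTwoPortProductForm` (gen 55: `card_bad_substitution`, `card_sa_substitution`, `productForm_of_twoPort`).  Standard axioms, no sorries,
no named facts, no definitions.  Memo `run/shared/lean/prim/prim-sahi/FROM-prim-sahi-p2-gen56-REFINED-PRODUCT-FORM.md` §9(0), §10 and the gen-57 memo.

Setting of R4 (terminal-free network with interior `Nv`, ports `p, q`, apex `a` and terminals `s, c` outside; `zn / zr` = network / rest labels,
`Rr z e` = rest connection with the virtual edge `pq` iff `e`, `Fl z e` = rest flat, `Fn z πp πq` = network flip, `A', CD', DD'` = antithetic class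
sizes of the network).  With the rest events `Wd z e e' :≡ (Rr z e a s ∧ ¬Rr z e a c) ∧ (s ↔ c in Fl z e with virtual edge iff e')` (abstract
predicate with defining clause `hWd`) and `ω(e,πp,πq,e') := #{Pat(e,πp,πq) ∧ Wd(e,e')}`:
* `filter_w_piece`, `card_w_piece_mul_univ` [this work] — the `w`-analogues of `filter_bad_piece`, `card_piece_mul_univ`.
* **`card_w_substitution`** [this work] — `#w·#univ = A'·Σ_π ω(1,π,1) + CD'·(ω(1,∅,1) + ω(0,∅,0) + Σ_{π≠∅}(ω(1,π,0) + ω(0,π,1))) + DD'·Σ_π ω(0,π,0)`,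
  `w = #{(a ↔ s ∧ a ↮ c in z) ∧ s ↔ c in ♭ₐz}` — the same interface weights as `#bad` (`card_bad_substitution`).
* **`card_joined_substitution`** [this work] — `#J·#univ = (A' + CD')·ι(1) + (CD' + DD')·ι(0)`, `ι(e) := #{Rr z e a s ∧ Rr z e a c}`, `J = {a ↔ s, a ↔ c}`.
* **`S1J_of_twoPort`** [this work] — REDUCTION R4 FOR (S1J): if the three comparison triples (CONTRACT, ONE EDGE, DELETE — the same brackets as in
  `productForm_of_twoPort`, with `ρ + ω` in place of `ρ` and `ι` in place of `σ₂`) each satisfy `(b + w)² ≤ p·j`, then `(#bad + #w)² ≤ #P1·#J` on the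
  whole multigraph.  With `productForm_of_twoPort` (and the mirror `s ↔ c` for (S1J′)) every member of 𝒮 transfers through a terminal-free 2-cut, so a
  minimal counterexample to 𝒮 has every terminal-free 2-cut side a single label (memo §10: with R0–R3, it is 2-connected with `s, a, c` inside).
[folklore] (counting, Cauchy–Schwarz); [cite: Gladkov2024, Conjecture 10.1 (p. 18), arXiv:2408.08457] for CONJECTURE (P) / the system 𝒮 served.
-/

namespace Summit.CriticalPhenomena.PercolationContinuityZ3.Theorems.ProductFormFibre

open Finset Literature.Probability.Percolation
open Summit.CriticalPhenomena.PercolationContinuityZ3.Theorems.ThreePointCPIClusterSwap (clusterFlip)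

variable {V α : Type*}

section TwoPortS1JCount

open Classical

variable [Fintype α] [DecidableEq α] (ends endsN : α → Sym2 V) (p q a s c : V) (Nv : Set V) (inN : α → Prop)
  (hN1 : ∀ l, inN l → ∀ v ∈ ends l, v ∈ Nv ∨ v = p ∨ v = q) (hN2 : ∀ l, ¬ inN l → ∀ v ∈ ends l, v ∉ Nv)
  (hp : p ∉ Nv) (hq : q ∉ Nv) (ha : a ∉ Nv) (hs : s ∉ Nv) (hc : c ∉ Nv)
  (hE1 : ∀ l, inN l → endsN l = ends l) (hE2 : ∀ l, ¬ inN l → endsN l = s(p, p))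
  (zn zr : (α → Bool) → α → Bool)
  (hzn : ∀ z l, inN l → zn z l = z l) (hzn0 : ∀ z l, ¬ inN l → zn z l = false)
  (hzr : ∀ z l, ¬ inN l → zr z l = z l) (hzr0 : ∀ z l, inN l → zr z l = false)
  (Rr : (α → Bool) → Bool → V → V → Prop)
  (hRr : ∀ z e u v, Rr z e u v ↔
    ((openGraph (labelledOpen ends (zr z))).Reachable u v ∨
      (e = true ∧ (((openGraph (labelledOpen ends (zr z))).Reachable u p ∧ (openGraph (labelledOpen ends (zr z))).Reachable q v) ∨
        ((openGraph (labelledOpen ends (zr z))).Reachable u q ∧ (openGraph (labelledOpen ends (zr z))).Reachable p v)))))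
  (Fl : (α → Bool) → Bool → α → Bool)
  (hFl1 : ∀ z e l, ¬ inN l → (∃ v ∈ ends l, Rr z e a v) → Fl z e l = !z l)
  (hFl2 : ∀ z e l, ¬ inN l → ¬ (∃ v ∈ ends l, Rr z e a v) → Fl z e l = z l)
  (hFl0 : ∀ z e l, inN l → Fl z e l = false)
  (Fn : (α → Bool) → Bool → Bool → α → Bool)
  (hFn1 : ∀ z πp πq l, inN l →
    ((πp = true ∧ ∃ v ∈ ends l, (openGraph (labelledOpen ends (zn z))).Reachable p v) ∨
      (πq = true ∧ ∃ v ∈ ends l, (openGraph (labelledOpen ends (zn z))).Reachable q v)) → Fn z πp πq l = !z l)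
  (hFn2 : ∀ z πp πq l, inN l →
    ¬ ((πp = true ∧ ∃ v ∈ ends l, (openGraph (labelledOpen ends (zn z))).Reachable p v) ∨
      (πq = true ∧ ∃ v ∈ ends l, (openGraph (labelledOpen ends (zn z))).Reachable q v)) → Fn z πp πq l = z l)
  (hFn0 : ∀ z πp πq l, ¬ inN l → Fn z πp πq l = false)
  -- the rest events, abstractly: `Bd z e e'` = BadR, `Wd z e e'` = the rest form of `w`
  (Bd : (α → Bool) → Bool → Bool → Prop)
  (hBd : ∀ z e e', Bd z e e' ↔
    ((¬ Rr z e a s ∧ ¬ Rr z e a c ∧ ¬ Rr z e s c) ∧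
      ((openGraph (labelledOpen ends (Fl z e))).Reachable s c ∨
        (e' = true ∧ (((openGraph (labelledOpen ends (Fl z e))).Reachable s p ∧ (openGraph (labelledOpen ends (Fl z e))).Reachable q c) ∨
          ((openGraph (labelledOpen ends (Fl z e))).Reachable s q ∧ (openGraph (labelledOpen ends (Fl z e))).Reachable p c))))))
  (Wd : (α → Bool) → Bool → Bool → Prop)
  (hWd : ∀ z e e', Wd z e e' ↔
    ((Rr z e a s ∧ ¬ Rr z e a c) ∧
      ((openGraph (labelledOpen ends (Fl z e))).Reachable s c ∨
        (e' = true ∧ (((openGraph (labelledOpen ends (Fl z e))).Reachable s p ∧ (openGraph (labelledOpen ends (Fl z e))).Reachable q c) ∨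
          ((openGraph (labelledOpen ends (Fl z e))).Reachable s q ∧ (openGraph (labelledOpen ends (Fl z e))).Reachable p c))))))
  (A' CD' DD' : ℕ)
  (hA' : A' = (univ.filter fun w : α → Bool => (openGraph (labelledOpen ends (zn w))).Reachable p q ∧
    (openGraph (labelledOpen ends (zn fun l => !w l))).Reachable p q).card)
  (hCD' : CD' = (univ.filter fun w : α → Bool => (openGraph (labelledOpen ends (zn w))).Reachable p q ∧
    ¬ (openGraph (labelledOpen ends (zn fun l => !w l))).Reachable p q).card)
  (hDD' : DD' = (univ.filter fun w : α → Bool => ¬ (openGraph (labelledOpen ends (zn w))).Reachable p q ∧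
    ¬ (openGraph (labelledOpen ends (zn fun l => !w l))).Reachable p q).card)

/-! ### 1. The decomposition of `w` -/

include hN1 hN2 hp hq ha hs hc hzn hzn0 hzr hzr0 hRr hFl1 hFl2 hFl0 hFn1 hFn2 hFn0 hWd in
/-- **One piece of `w`.**  For fixed `(e, πp, πq, e')`, the `w`-configurations (`a ↔ s`, `a ↮ c`, `s ↔ c` in the flat) with these true values are
exactly the configurations in the network event `NE(e,πp,πq,e')` and in the rest event `Pat(e,πp,πq) ∧ Wd(e,e')` (`w_iff_restW`). [this work] -/
theorem filter_w_piece (e πp πq e' : Bool) :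
    (univ.filter fun z : α → Bool =>
      (((((((openGraph (labelledOpen ends z)).Reachable a s ∧ ¬ (openGraph (labelledOpen ends z)).Reachable a c) ∧
        (openGraph (labelledOpen ends (clusterFlip ends a fun x => !z x))).Reachable s c) ∧
        ((openGraph (labelledOpen ends (zn z))).Reachable p q ↔ e = true)) ∧
        (Rr z e a p ↔ πp = true)) ∧
        (Rr z e a q ↔ πq = true)) ∧
        ((openGraph (labelledOpen ends (Fn z πp πq))).Reachable p q ↔ e' = true))) =
    (univ.filter fun z : α → Bool =>
      (((openGraph (labelledOpen ends (zn z))).Reachable p q ↔ e = true) ∧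
        ((openGraph (labelledOpen ends (Fn z πp πq))).Reachable p q ↔ e' = true)) ∧
      (((Rr z e a p ↔ πp = true) ∧ (Rr z e a q ↔ πq = true)) ∧ Wd z e e')) := by
  refine Finset.filter_congr fun z _ => ?_
  constructor
  · rintro ⟨⟨⟨⟨hw, he⟩, hπp⟩, hπq⟩, he'⟩
    refine ⟨⟨he, he'⟩, ⟨hπp, hπq⟩, (hWd z e e').2 ?_⟩
    exact (w_iff_restW ends p q a Nv inN hN1 hN2 hp hq ha zn zr hzn hzn0 hzr hzr0 Rr hRr Fl hFl1 hFl2 hFl0 Fn hFn1 hFn2 hFn0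
      z e πp πq e' hs hc he hπp hπq he').1 hw
  · rintro ⟨⟨he, he'⟩, ⟨hπp, hπq⟩, hW⟩
    refine ⟨⟨⟨⟨?_, he⟩, hπp⟩, hπq⟩, he'⟩
    exact (w_iff_restW ends p q a Nv inN hN1 hN2 hp hq ha zn zr hzn hzn0 hzr hzr0 Rr hRr Fl hFl1 hFl2 hFl0 Fn hFn1 hFn2 hFn0
      z e πp πq e' hs hc he hπp hπq he').2 ((hWd z e e').1 hW)

variable [DecidablePred inN]

include hzn hzn0 hzr hzr0 hRr hFl1 hFl2 hFl0 hFn1 hFn2 hFn0 hWd in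
/-- **Independence of the `w`-piece**: `#{NE ∧ (Pat ∧ Wd)}·#univ = #NE · #(Pat ∧ Wd)`. [this work] -/
theorem card_w_piece_mul_univ (e πp πq e' : Bool) :
    (univ.filter fun z : α → Bool =>
      (((openGraph (labelledOpen ends (zn z))).Reachable p q ↔ e = true) ∧
        ((openGraph (labelledOpen ends (Fn z πp πq))).Reachable p q ↔ e' = true)) ∧
      (((Rr z e a p ↔ πp = true) ∧ (Rr z e a q ↔ πq = true)) ∧ Wd z e e')).card * (univ : Finset (α → Bool)).card =
    (univ.filter fun z : α → Bool =>
      ((openGraph (labelledOpen ends (zn z))).Reachable p q ↔ e = true) ∧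
        ((openGraph (labelledOpen ends (Fn z πp πq))).Reachable p q ↔ e' = true)).card *
    (univ.filter fun z : α → Bool => ((Rr z e a p ↔ πp = true) ∧ (Rr z e a q ↔ πq = true)) ∧ Wd z e e').card := by
  refine card_and_mul_card_univ inN _ _ ?_ ?_
  · intro z z' h hz
    rwa [zn_eq_of_agree inN zn hzn hzn0 h, Fn_eq_of_agree ends p q inN zn hzn hzn0 Fn hFn1 hFn2 hFn0 h] at hz
  · intro z z' h hz
    have hR := fun (e : Bool) (u v : V) => Rr_iff_of_agree ends p q inN zr hzr hzr0 Rr hRr h e u v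
    rw [hR, hR, hWd, hR, hR, Fl_eq_of_agree ends p q a inN zr hzr hzr0 Rr hRr Fl hFl1 hFl2 hFl0 h] at hz
    rw [hWd]; exact hz

/-! ### 2. The substitution identity for `w` -/

include hN1 hN2 hp hq ha hs hc hE1 hE2 hzn hzn0 hzr hzr0 hRr hFl1 hFl2 hFl0 hFn1 hFn2 hFn0 hWd hA' hCD' hDD' in
/-- **THE TWO-TERMINAL SUBSTITUTION IDENTITY FOR `w`.**  With `ω(e,πp,πq,e') = #{Pat(e,πp,πq) ∧ Wd(e,e')}` (rest counts) and the antithetic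
class sizes `A', CD', DD'` of the network:
`#w·#univ = A'·Σ_π ω(1,π,1) + CD'·(ω(1,∅,1) + ω(0,∅,0) + Σ_{π ≠ ∅}(ω(1,π,0) + ω(0,π,1))) + DD'·Σ_π ω(0,π,0)` — the same weights as for `#bad`. [this work] -/
theorem card_w_substitution (ω : Bool → Bool → Bool → Bool → ℕ)
    (hω : ∀ e πp πq e', ω e πp πq e' =
      (univ.filter fun z : α → Bool => ((Rr z e a p ↔ πp = true) ∧ (Rr z e a q ↔ πq = true)) ∧ Wd z e e').card) :
    (univ.filter fun z : α → Bool =>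
        ((openGraph (labelledOpen ends z)).Reachable a s ∧ ¬ (openGraph (labelledOpen ends z)).Reachable a c) ∧
        (openGraph (labelledOpen ends (clusterFlip ends a fun x => !z x))).Reachable s c).card * (univ : Finset (α → Bool)).card =
      A' * (ω true true true true + ω true true false true + ω true false true true + ω true false false true) +
      CD' * (ω true false false true + ω false false false false +
        (ω true true true false + ω false true true true) + (ω true true false false + ω false true false true) +
        (ω true false true false + ω false false true true)) +
      DD' * (ω false true true false + ω false true false false + ω false false true false + ω false false false false) := by
  have hsplit := card_split4
    (fun z : α → Bool => ((openGraph (labelledOpen ends z)).Reachable a s ∧ ¬ (openGraph (labelledOpen ends z)).Reachable a c) ∧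
      (openGraph (labelledOpen ends (clusterFlip ends a fun x => !z x))).Reachable s c)
    (fun z => (openGraph (labelledOpen ends (zn z))).Reachable p q)
    (fun e z => Rr z e a p) (fun e z => Rr z e a q)
    (fun e πp πq z => (openGraph (labelledOpen ends (Fn z πp πq))).Reachable p q)
  -- each piece, multiplied by `#univ`, is `ν · ω`
  have hpiece : ∀ e πp πq e' : Bool, (univ.filter fun z : α → Bool =>
      (((((((openGraph (labelledOpen ends z)).Reachable a s ∧ ¬ (openGraph (labelledOpen ends z)).Reachable a c) ∧
        (openGraph (labelledOpen ends (clusterFlip ends a fun x => !z x))).Reachable s c) ∧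
        ((openGraph (labelledOpen ends (zn z))).Reachable p q ↔ e = true)) ∧
        (Rr z e a p ↔ πp = true)) ∧
        (Rr z e a q ↔ πq = true)) ∧
        ((openGraph (labelledOpen ends (Fn z πp πq))).Reachable p q ↔ e' = true))).card * (univ : Finset (α → Bool)).card =
      (bif (πp || πq) then (bif e then (bif e' then A' else CD') else (bif e' then CD' else DD'))
        else (bif (e == e') then (bif e then A' + CD' else CD' + DD') else 0)) * ω e πp πq e' := by
    intro e πp πq e'
    rw [filter_w_piece ends p q a s c Nv inN hN1 hN2 hp hq ha hs hc zn zr hzn hzn0 hzr hzr0 Rr hRr Fl hFl1 hFl2 hFl0 Fn hFn1 hFn2 hFn0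
      Wd hWd e πp πq e',
      card_w_piece_mul_univ ends p q a s c inN zn zr hzn hzn0 hzr hzr0 Rr hRr Fl hFl1 hFl2 hFl0 Fn hFn1 hFn2 hFn0 Wd hWd e πp πq e',
      card_NE_eq ends endsN p q inN hE1 hE2 zn hzn hzn0 Fn hFn1 hFn2 hFn0 A' CD' DD' hA' hCD' hDD' e πp πq e', hω]
  beta_reduce at hsplit
  rw [hsplit]
  simp only [Finset.sum_mul]
  simp only [hpiece]
  simp only [Fintype.sum_bool, Bool.true_or, Bool.false_or, cond_true, cond_false, beq_self_eq_true,
    show (true == false) = false from rfl, show (false == true) = false from rfl]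
  ring

/-! ### 3. The substitution identity for `J` -/

include hN1 hN2 ha hs hc hzn hzn0 hzr hzr0 hRr hA' hCD' hDD' in
/-- **THE SUBSTITUTION IDENTITY FOR `#J`**: with `ι(e) := #{Rr z e a s ∧ Rr z e a c}`,
`#{a ↔ s, a ↔ c}·#univ = (A' + CD')·ι(1) + (CD' + DD')·ι(0)`. [this work] -/
theorem card_joined_substitution :
    (univ.filter fun z : α → Bool =>
        (openGraph (labelledOpen ends z)).Reachable a s ∧ (openGraph (labelledOpen ends z)).Reachable a c).card *
      (univ : Finset (α → Bool)).card =
    (A' + CD') * (univ.filter fun z : α → Bool => Rr z true a s ∧ Rr z true a c).card +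
    (CD' + DD') * (univ.filter fun z : α → Bool => Rr z false a s ∧ Rr z false a c).card := by
  have hsplit := card_filter_split_bool
    (fun z : α → Bool => (openGraph (labelledOpen ends z)).Reachable a s ∧ (openGraph (labelledOpen ends z)).Reachable a c)
    (fun z => (openGraph (labelledOpen ends (zn z))).Reachable p q)
  have hpiece : ∀ e : Bool, (univ.filter fun z : α → Bool =>
      ((openGraph (labelledOpen ends z)).Reachable a s ∧ (openGraph (labelledOpen ends z)).Reachable a c) ∧
        ((openGraph (labelledOpen ends (zn z))).Reachable p q ↔ e = true)).card * (univ : Finset (α → Bool)).card =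
      (bif e then A' + CD' else CD' + DD') * (univ.filter fun z : α → Bool => Rr z e a s ∧ Rr z e a c).card := by
    intro e
    have hre : (univ.filter fun z : α → Bool =>
        ((openGraph (labelledOpen ends z)).Reachable a s ∧ (openGraph (labelledOpen ends z)).Reachable a c) ∧
          ((openGraph (labelledOpen ends (zn z))).Reachable p q ↔ e = true)) =
      (univ.filter fun z : α → Bool => ((openGraph (labelledOpen ends (zn z))).Reachable p q ↔ e = true) ∧
        (Rr z e a s ∧ Rr z e a c)) := by
      refine Finset.filter_congr fun z _ => ?_
      constructor
      · rintro ⟨h, he⟩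
        exact ⟨he, (joined_iff_rest ends p q a Nv inN hN1 hN2 ha zn zr hzn hzn0 hzr hzr0 Rr hRr z e hs hc he).1 h⟩
      · rintro ⟨he, h⟩
        exact ⟨(joined_iff_rest ends p q a Nv inN hN1 hN2 ha zn zr hzn hzn0 hzr hzr0 Rr hRr z e hs hc he).2 h, he⟩
    rw [hre, ← card_conn_iff_split ends p q zn A' CD' DD' hA' hCD' hDD' e]
    refine card_and_mul_card_univ inN _ _ ?_ ?_
    · intro z z' h hz
      rwa [zn_eq_of_agree inN zn hzn hzn0 h] at hz
    · intro z z' h hz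
      have hR := fun (e : Bool) (u v : V) => Rr_iff_of_agree ends p q inN zr hzr hzr0 Rr hRr h e u v
      rwa [hR, hR] at hz
  beta_reduce at hsplit
  rw [hsplit, Nat.add_mul, hpiece true, hpiece false]
  simp only [cond_true, cond_false]

/-! ### 4. Reduction R4 for (S1J) -/

include hN1 hN2 hp hq ha hs hc hE1 hE2 hzn hzn0 hzr hzr0 hRr hFl1 hFl2 hFl0 hFn1 hFn2 hFn0 hBd hWd hA' hCD' hDD' in
/-- **REDUCTION R4 FOR (S1J): `(#bad + #w)² ≤ #P1·#J` TRANSFERS THROUGH A TERMINAL-FREE TWO-TERMINAL NETWORK.**  Let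
`ρ(e,πp,πq,e') = #{Pat ∧ BadR(e,e')}`, `ω(e,πp,πq,e') = #{Pat ∧ Wd(e,e')}`, `σ₁(e) = #{Rr z e a s ∧ ¬Rr z e a c}`, `ι(e) = #{Rr z e a s ∧ Rr z e a c}`
be the rest counts.  If the three comparison triples — CONTRACT `(Σ_π (ρ+ω)(1,π,1), σ₁ 1, ι 1)`, ONE EDGE
`((ρ+ω)(1,∅,1) + (ρ+ω)(0,∅,0) + Σ_{π≠∅}((ρ+ω)(1,π,0) + (ρ+ω)(0,π,1)), σ₁ 1 + σ₁ 0, ι 1 + ι 0)`, DELETE `(Σ_π (ρ+ω)(0,π,0), σ₁ 0, ι 0)` — each satisfy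
`b² ≤ p·j`, then `(#bad + #w)² ≤ #P1·#J` for the terminals `(s, a, c)` on the whole multigraph (the three triples are `(#bad + #w, #P1, #J)` of
`H/N`, `H[N → pq]`, `H − N` written on the rest's labels). [this work] -/
theorem S1J_of_twoPort (ρ ω : Bool → Bool → Bool → Bool → ℕ)
    (hρ : ∀ e πp πq e', ρ e πp πq e' =
      (univ.filter fun z : α → Bool => ((Rr z e a p ↔ πp = true) ∧ (Rr z e a q ↔ πq = true)) ∧ Bd z e e').card)
    (hω : ∀ e πp πq e', ω e πp πq e' =
      (univ.filter fun z : α → Bool => ((Rr z e a p ↔ πp = true) ∧ (Rr z e a q ↔ πq = true)) ∧ Wd z e e').card)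
    (σ₁ ι : Bool → ℕ)
    (hσ₁ : ∀ e, σ₁ e = (univ.filter fun z : α → Bool => Rr z e a s ∧ ¬ Rr z e a c).card)
    (hι : ∀ e, ι e = (univ.filter fun z : α → Bool => Rr z e a s ∧ Rr z e a c).card)
    (hcon : ((ρ true true true true + ρ true true false true + ρ true false true true + ρ true false false true) +
        (ω true true true true + ω true true false true + ω true false true true + ω true false false true)) ^ 2 ≤ σ₁ true * ι true)
    (hedge : ((ρ true false false true + ρ false false false false +
        (ρ true true true false + ρ false true true true) + (ρ true true false false + ρ false true false true) +
        (ρ true false true false + ρ false false true true)) +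
        (ω true false false true + ω false false false false +
        (ω true true true false + ω false true true true) + (ω true true false false + ω false true false true) +
        (ω true false true false + ω false false true true))) ^ 2 ≤ (σ₁ true + σ₁ false) * (ι true + ι false))
    (hdel : ((ρ false true true false + ρ false true false false + ρ false false true false + ρ false false false false) +
        (ω false true true false + ω false true false false + ω false false true false + ω false false false false)) ^ 2 ≤
      σ₁ false * ι false) :
    ((univ.filter fun z : α → Bool =>
        (¬ (openGraph (labelledOpen ends z)).Reachable a s ∧ ¬ (openGraph (labelledOpen ends z)).Reachable a c ∧
          ¬ (openGraph (labelledOpen ends z)).Reachable s c) ∧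
        (openGraph (labelledOpen ends (clusterFlip ends a fun x => !z x))).Reachable s c).card +
      (univ.filter fun z : α → Bool =>
        ((openGraph (labelledOpen ends z)).Reachable a s ∧ ¬ (openGraph (labelledOpen ends z)).Reachable a c) ∧
        (openGraph (labelledOpen ends (clusterFlip ends a fun x => !z x))).Reachable s c).card) ^ 2 ≤
    (univ.filter fun z : α → Bool =>
        (openGraph (labelledOpen ends z)).Reachable a s ∧ ¬ (openGraph (labelledOpen ends z)).Reachable a c).card *
    (univ.filter fun z : α → Bool =>
        (openGraph (labelledOpen ends z)).Reachable a s ∧ (openGraph (labelledOpen ends z)).Reachable a c).card := by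
  have hbad := card_bad_substitution ends endsN p q a s c Nv inN hN1 hN2 hp hq ha hs hc hE1 hE2 zn zr hzn hzn0 hzr hzr0 Rr hRr
    Fl hFl1 hFl2 hFl0 Fn hFn1 hFn2 hFn0 Bd hBd ρ hρ A' CD' DD' hA' hCD' hDD'
  have hwsub := card_w_substitution ends endsN p q a s c Nv inN hN1 hN2 hp hq ha hs hc hE1 hE2 zn zr hzn hzn0 hzr hzr0 Rr hRr
    Fl hFl1 hFl2 hFl0 Fn hFn1 hFn2 hFn0 Wd hWd A' CD' DD' hA' hCD' hDD' ω hω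
  have hP1 := card_sa_substitution ends p q a s c Nv inN hN1 hN2 ha hs hc zn zr hzn hzn0 hzr hzr0 Rr hRr A' CD' DD' hA' hCD' hDD'
  have hJ := card_joined_substitution ends p q a s c Nv inN hN1 hN2 ha hs hc zn zr hzn hzn0 hzr hzr0 Rr hRr A' CD' DD' hA' hCD' hDD'
  rw [← hσ₁, ← hσ₁] at hP1
  rw [← hι, ← hι] at hJ
  set U := (univ : Finset (α → Bool)).card with hU
  set B := (univ.filter fun z : α → Bool =>
        (¬ (openGraph (labelledOpen ends z)).Reachable a s ∧ ¬ (openGraph (labelledOpen ends z)).Reachable a c ∧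
          ¬ (openGraph (labelledOpen ends z)).Reachable s c) ∧
        (openGraph (labelledOpen ends (clusterFlip ends a fun x => !z x))).Reachable s c).card with hB
  set W := (univ.filter fun z : α → Bool =>
        ((openGraph (labelledOpen ends z)).Reachable a s ∧ ¬ (openGraph (labelledOpen ends z)).Reachable a c) ∧
        (openGraph (labelledOpen ends (clusterFlip ends a fun x => !z x))).Reachable s c).card with hW
  set Q1 := (univ.filter fun z : α → Bool =>
        (openGraph (labelledOpen ends z)).Reachable a s ∧ ¬ (openGraph (labelledOpen ends z)).Reachable a c).card with hQ1
  set QJ := (univ.filter fun z : α → Bool =>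
        (openGraph (labelledOpen ends z)).Reachable a s ∧ (openGraph (labelledOpen ends z)).Reachable a c).card with hQJ
  have hUpos : 0 < U := Finset.card_pos.mpr Finset.univ_nonempty
  -- the three-term cone lemma on the substituted forms
  have key := sq_sum3_le A' CD' DD' _ _ _ _ _ _ _ _ _ hcon hedge hdel
  have eB : (B + W) * U =
      A' * ((ρ true true true true + ρ true true false true + ρ true false true true + ρ true false false true) +
        (ω true true true true + ω true true false true + ω true false true true + ω true false false true)) +
      CD' * ((ρ true false false true + ρ false false false false +
        (ρ true true true false + ρ false true true true) + (ρ true true false false + ρ false true false true) +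
        (ρ true false true false + ρ false false true true)) +
        (ω true false false true + ω false false false false +
        (ω true true true false + ω false true true true) + (ω true true false false + ω false true false true) +
        (ω true false true false + ω false false true true))) +
      DD' * ((ρ false true true false + ρ false true false false + ρ false false true false + ρ false false false false) +
        (ω false true true false + ω false true false false + ω false false true false + ω false false false false)) := by
    rw [Nat.add_mul, hbad, hwsub]; ring
  have eQ1 : Q1 * U = A' * σ₁ true + CD' * (σ₁ true + σ₁ false) + DD' * σ₁ false := by rw [hP1]; ring
  have eQJ : QJ * U = A' * ι true + CD' * (ι true + ι false) + DD' * ι false := by rw [hJ]; ring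
  have key' : ((B + W) * U) ^ 2 ≤ (Q1 * U) * (QJ * U) := by rw [eB, eQ1, eQJ]; exact key
  have key'' : (B + W) ^ 2 * (U * U) ≤ Q1 * QJ * (U * U) := by
    calc (B + W) ^ 2 * (U * U) = ((B + W) * U) ^ 2 := by ring
      _ ≤ (Q1 * U) * (QJ * U) := key'
      _ = Q1 * QJ * (U * U) := by ring
  exact Nat.le_of_mul_le_mul_right key'' (Nat.mul_pos hUpos hUpos)

end TwoPortS1JCount

end Summit.CriticalPhenomena.PercolationContinuityZ3.Theorems.ProductFormFibre
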